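import Literature.Probability.LatticeModels.StrassenHolleyCoupling
import Summits.CriticalPhenomena.PercolationContinuityZ3.Theorems.PercNearOneGluingNoHeavyLowerTailC3Transport
import HarnessLib
import HarnessLib.Audit

/-!
# `NoHeavyLowerTail` (crux stmt-CriticalPhenomena-4575), Sahi programme P4: the transport form of
# `C₃` is EQUIVALENT to `C₃` (Strassen / supply–demand on the finite poset)

Support file (`--supports stmt-CriticalPhenomena-4575`).  `…C3Transport.lean` proved the sound
direction `HasC3Flow μ A B → ∀ up-sets U, latticeE3 μ U A B ≥ 0` and left "the hard direction
(Strassen / max-flow–min-cut) not formalised".  With the Literature theorem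
`Literature.Probability.LatticeModels.exists_upwardTransfer_of_upperSets_nonneg` (Strassen's
theorem on a finite preorder in transfer form, `StrassenHolleyCoupling.lean`) the two are
equivalent, and the conjecture `C3FlowFormFKG` is literally the indicator form of Sahi's `C₃`
for FKG weights.  Theorems only.
-/

namespace Summit.CriticalPhenomena.PercolationContinuityZ3.Theorems.C3Transport

open Finset Literature.Probability.LatticeModels

variable {α : Type*} [Fintype α] [DecidableEq α] [Preorder α]

/-- **`C₃` in the first slot ⇒ a `C₃`-flow** (the hard direction, by Strassen's theorem in transfer
form): if `latticeE3 μ U A B ≥ 0` for every up-set `U`, then `HasC3Flow μ A B`. -/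
theorem hasC3Flow_of_forall_upperSet {μ : α → ℝ} {A B : Finset α}
    (h : ∀ U : Finset α, IsUpperSet (U : Set α) → 0 ≤ latticeE3 μ U A B) : HasC3Flow μ A B := by
  obtain ⟨f, hf0, hsupp, hdiv⟩ := exists_upwardTransfer_of_upperSets_nonneg
    (fun z => μ z * density μ A B z) (fun U hU => by rw [← latticeE3_eq_sum_density]; exact h U hU)
  exact ⟨f, ⟨hf0, hsupp⟩, hdiv⟩

/-- **Transport form ⟺ `C₃` in the first slot.** -/
theorem hasC3Flow_iff_forall_upperSet {μ : α → ℝ} {A B : Finset α} :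
    HasC3Flow μ A B ↔ ∀ U : Finset α, IsUpperSet (U : Set α) → 0 ≤ latticeE3 μ U A B :=
  ⟨fun h _ hU => latticeE3_nonneg_of_hasC3Flow h hU, hasC3Flow_of_forall_upperSet⟩

/-- **`C3FlowFormFKG` ⟺ the indicator form of Sahi's `C₃` for FKG weights** (all finite
distributive lattices, all nonnegative log-supermodular weights, all triples of up-sets). -/
theorem c3FlowFormFKG_iff :
    C3FlowFormFKG ↔
    ∀ (β : Type) [DistribLattice β] [Fintype β] [DecidableEq β] (μ : β → ℝ), 0 ≤ μ →
      (∀ a b, μ a * μ b ≤ μ (a ⊓ b) * μ (a ⊔ b)) →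
      ∀ A B C : Finset β, IsUpperSet (A : Set β) → IsUpperSet (B : Set β) → IsUpperSet (C : Set β) →
        0 ≤ latticeE3 μ A B C := by
  constructor
  · intro h β _ _ _ μ hμ₀ hμ A B C hA hB hC
    exact latticeE3_nonneg_of_c3FlowFormFKG h β hμ₀ hμ hA hB hC
  · intro h β _ _ _ μ hμ₀ hμ A B hA hB
    exact hasC3Flow_of_forall_upperSet fun U hU => h β μ hμ₀ hμ U A B hU hA hB

end Summit.CriticalPhenomena.PercolationContinuityZ3.Theorems.C3Transport
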